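import Summits.CriticalPhenomena.PercolationContinuityZ3.Theorems.PercNearOneGluingNoHeavyLowerTailCondCertCore
import HarnessLib

/-!
# `NoHeavyLowerTail` (stmt-CriticalPhenomena-4575) — `COND₃`/`KN13` certificate wrapper, part 3: all weights, the route's vocabulary,
# Kozma–Nitzan's Conjecture 1 for `|A| ≤ 3` from a `COND₃` certificate

Support file (prover prim-ineq-prove-1; `--supports stmt-CriticalPhenomena-4575`).  No sorries.
* `cond_max_of_injective` — interior ⇒ all weights (mixed weights `mixW`, weight continuity, a relay that is worst FREQUENTLY along the
  approximating sequence, relay transpositions `swapT`): `μ(X) ≤ μ(oA) · max_j μ(D_j)` for every injective placement;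
* `condGluing_three_of_cert` (named distinct vertices), `condGluing_card_le_three_of_cert` (every `A.card ≤ 3`; coincident vertices elementary,
  `|A| ≤ 2` = `CondGluing.condGluing_card_le_two`), `kozmaNitzan_conjecture1_card_le_three_of_cert` (via
  `CondGluing.kozmaNitzan_conjecture1_of_condGluing_at`).
[cite: KozmaNitzan2024, Conjecture 1 (p. 3)]
-/

noncomputable section

namespace Summit.CriticalPhenomena.PercolationContinuityZ3.Theorems

open MeasureTheory Set Filter Literature.Probability.Percolation
open Literature.Probability.LatticeModels (prodBernoulli)
open scoped Classical BigOperators Topology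
open PatternCells CertCheck CertCells PatternSunflower

namespace CondCert

variable {n : ℕ}

/-! ## The `COND₃` instance: soundness at the cell law and at interior weights -/

/-- A hypothesis pair among `condHyps` holds when `μ(D₂), μ(D₃) ≤ μ(D₁)`. [folklore] -/
theorem condHyps_holds (w : Sym2 (Fin n) → unitInterval) (v : Fin 5 → Fin n)
    (h2 : (prodBernoulli w).real ((fD 2).set v) ≤ (prodBernoulli w).real ((fD 1).set v))
    (h3 : (prodBernoulli w).real ((fD 3).set v) ≤ (prodBernoulli w).real ((fD 1).set v))
    {q : Fin 5 × Fin 5} (hq : q ∈ condHyps) :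
    (prodBernoulli w).real ((fD q.1).set v) ≤ (prodBernoulli w).real ((fD q.2).set v) := by
  simp only [condHyps, List.mem_cons, List.mem_nil_iff, or_false] at hq
  rcases hq with rfl | rfl
  · exact h2
  · exact h3

/-- **Soundness at the cell law.**  Valid rows, all buckets pass, the two hypotheses hold for the placement `v` ⇒
`0 ≤ M₀(x) · (μ(oA)μ(D₁) − μ(X))` at `x_c = μ(Cell v c)`. [folklore] -/
theorem sound (C : CondCert) (hvalid : valid C = true) (hxs : C.ExtSound) {nb : ℕ} (hnb : 0 < nb) (hcheck : ∀ b < nb, checkB C nb b = true)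
    (w : Sym2 (Fin n) → unitInterval) (v : Fin 5 → Fin n)
    (h2 : (prodBernoulli w).real ((fD 2).set v) ≤ (prodBernoulli w).real ((fD 1).set v))
    (h3 : (prodBernoulli w).real ((fD 3).set v) ≤ (prodBernoulli w).real ((fD 1).set v)) :
    0 ≤ m0tot (fun m => (prodBernoulli w).real (Cell v m)) C *
      ((prodBernoulli w).real (fOA.set v) * (prodBernoulli w).real ((fD 1).set v) - (prodBernoulli w).real (fX.set v)) := by
  simp only [valid, hypsWithin, Bool.and_eq_true, List.all_eq_true, decide_eq_true_eq] at hvalid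
  obtain ⟨hrv, ⟨⟨hl, hr⟩, hrk⟩, hlf⟩ := hvalid
  rw [← qval_qts]
  exact soundT C qts hrv hxs hnb hcheck w v (fun q hq => condHyps_holds w v h2 h3 (hl q hq))
    (fun h hh => condHyps_holds w v h2 h3 (hr h hh)) (fun h hh => condHyps_holds w v h2 h3 (hrk h hh))
    (fun h hh => condHyps_holds w v h2 h3 (hlf h hh))

/-- **Interior weights.**  Valid rows + all buckets + a positive term, all off-diagonal weights in `(0,1)`, `v` injective, and the
two hypotheses for the placement `v` ⇒ `μ(X.set v) ≤ μ(oA.set v) · μ(D₁.set v)`. [folklore] -/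
theorem cond_interior (C : CondCert) (hvalid : valid C = true) (hxs : C.ExtSound) {nb : ℕ} (hnb : 0 < nb)
    (hcheck : ∀ b < nb, checkB C nb b = true) (hterm : posTerm C = true)
    (w : Sym2 (Fin n) → unitInterval)
    (hw : ∀ e : Sym2 (Fin n), ¬ e.IsDiag → 0 < ((w e : unitInterval) : ℝ) ∧ ((w e : unitInterval) : ℝ) < 1)
    {v : Fin 5 → Fin n} (hv : Function.Injective v)
    (h2 : (prodBernoulli w).real ((fD 2).set v) ≤ (prodBernoulli w).real ((fD 1).set v))
    (h3 : (prodBernoulli w).real ((fD 3).set v) ≤ (prodBernoulli w).real ((fD 1).set v)) :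
    (prodBernoulli w).real (fX.set v) ≤ (prodBernoulli w).real (fOA.set v) * (prodBernoulli w).real ((fD 1).set v) := by
  have hM : 0 < m0tot (fun m => (prodBernoulli w).real (Cell v m)) C := m0tot_pos C hterm w hw hv
  have h := sound C hvalid hxs hnb hcheck w v h2 h3
  have := nonneg_of_mul_pos_left h hM
  linarith

/-! ## From interior weights and a fixed worst label to all weights and the maximum -/

/-- The relay index `j` (`0,1,2`) as a terminal (`1,2,3`). [folklore] -/
def relayT (j : Fin 3) : Fin 5 := ⟨j.val + 1, by omega⟩

/-- The relay transposition `(1 relayT j)` as a map of terminal indices. [folklore] -/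
def swapT (j : Fin 3) (i : Fin 5) : Fin 5 := if i = 1 then relayT j else if i = relayT j then 1 else i

/-- `swapT j` is injective, fixes `0` and `4`, sends `1` to `relayT j`, and permutes the relay terminals. [folklore] -/
theorem swapT_facts : ∀ j : Fin 3, Function.Injective (swapT j) ∧ swapT j 0 = 0 ∧ swapT j 4 = 4 ∧ swapT j 1 = relayT j ∧
    ∀ i : Fin 3, ∃ i' : Fin 3, swapT j (relayT i) = relayT i' := by decide

/-- Relabelling a one-literal separation formula `{t ↮ b}` along a map fixing `b`. [folklore] -/
theorem set_fD_comp (v : Fin 5 → Fin n) (σ : Fin 5 → Fin 5) (h4 : σ 4 = 4) (t : Fin 5) :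
    (fD t).set (v ∘ σ) = (fD (σ t)).set v := by
  ext ω
  simp only [fD, mem_set_single, List.mem_singleton, forall_eq, holds_false, Function.comp_apply, h4]

/-- `X` is symmetric under the relay transpositions. [folklore] -/
theorem set_fX_swap (v : Fin 5 → Fin n) (j : Fin 3) : fX.set (v ∘ swapT j) = fX.set v := by
  obtain ⟨_, h0, h4, h1, _⟩ := swapT_facts j
  ext ω
  fin_cases j <;>
    simp only [fX, swapT, relayT, mem_set_cons, not_mem_set_nil, List.mem_cons, List.not_mem_nil,
      forall_eq_or_imp, forall_eq, holds_true, holds_false, Function.comp_apply, Fin.isValue, Fin.reduceFinMk,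
      Fin.reduceEq, if_true, if_false, or_false] <;> tauto

/-- `oA` is symmetric under the relay transpositions. [folklore] -/
theorem set_fOA_swap (v : Fin 5 → Fin n) (j : Fin 3) : fOA.set (v ∘ swapT j) = fOA.set v := by
  ext ω
  fin_cases j <;>
    simp only [fOA, swapT, relayT, mem_set_cons, not_mem_set_nil, List.mem_singleton,
      forall_eq, holds_true, Function.comp_apply, Fin.isValue, Fin.reduceFinMk,
      Fin.reduceEq, if_true, if_false, or_false] <;> tauto

/-- A limit form: if `f k ≤ g k` frequently along `atTop` and `f → a`, `g → b`, then `a ≤ b`. [folklore] -/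
theorem le_of_frequently_le {f g : ℕ → ℝ} {a b : ℝ} (hf : Tendsto f atTop (𝓝 a)) (hg : Tendsto g atTop (𝓝 b))
    (h : ∃ᶠ k in atTop, f k ≤ g k) : a ≤ b := by
  by_contra hab
  push Not at hab
  have hev : ∀ᶠ k in atTop, g k < f k := hg.eventually_lt hf hab
  exact (h.and_eventually hev).exists.elim fun k hk => absurd hk.1 (not_le.2 hk.2)

/-- **The certificate theorem for `COND₃` (formula form, all weights, maximum over the relays).**  Valid rows + all buckets +
a positive term ⇒ for every weighted graph and every injective placement `v` of the five terminals,
`μ(X.set v) ≤ μ(oA.set v) · max_j μ(D_j.set v)`.  (Interior weights `mixW w k → w`: at each `k` some relay is worst, so one relay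
is worst frequently; the certificate at the correspondingly permuted placement and weight continuity give the bound with that
relay's `D_j`, which is below the maximum.) [folklore] -/
theorem cond_max_of_injective (C : CondCert) (hvalid : valid C = true) (hxs : C.ExtSound) {nb : ℕ} (hnb : 0 < nb)
    (hcheck : ∀ b < nb, checkB C nb b = true) (hterm : posTerm C = true)
    (w : Sym2 (Fin n) → unitInterval) {v : Fin 5 → Fin n} (hv : Function.Injective v) :
    (prodBernoulli w).real (fX.set v) ≤ (prodBernoulli w).real (fOA.set v) *
      max ((prodBernoulli w).real ((fD 1).set v)) (max ((prodBernoulli w).real ((fD 2).set v)) ((prodBernoulli w).real ((fD 3).set v))) := by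
  set μk : ℕ → Sym2 (Fin n) → unitInterval := fun k => mixW w k with hμk
  set d : ℕ → Fin 3 → ℝ := fun k j => (prodBernoulli (mixW w k)).real ((fD (relayT j)).set v) with hd
  -- at each k some relay is worst
  have hsome : ∀ k, ∃ j : Fin 3, ∀ i : Fin 3, d k i ≤ d k j := fun k =>
    Finset.exists_max_image Finset.univ (d k) Finset.univ_nonempty |>.imp fun j hj => fun i => hj.2 i (Finset.mem_univ i)
  -- hence one relay is worst frequently
  have hfreq : ∃ j : Fin 3, ∃ᶠ k in atTop, ∀ i : Fin 3, d k i ≤ d k j := by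
    by_contra hnone
    have hnone' : ∀ j : Fin 3, ∀ᶠ k in atTop, ¬ ∀ i : Fin 3, d k i ≤ d k j := fun j =>
      Filter.not_frequently.1 (fun h => hnone ⟨j, h⟩)
    have hall : ∀ᶠ k in atTop, ∀ j : Fin 3, ¬ ∀ i : Fin 3, d k i ≤ d k j := Filter.eventually_all.2 hnone'
    obtain ⟨k, hk⟩ := hall.exists
    obtain ⟨j, hj⟩ := hsome k
    exact hk j hj
  obtain ⟨j, hj⟩ := hfreq
  -- the certificate at the permuted placement, at the interior weights where `j` is worst
  obtain ⟨hinj, h0, h4, h1, hperm⟩ := swapT_facts j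
  have hvj : Function.Injective (v ∘ swapT j) := hv.comp hinj
  have hD1 : (fD 1).set (v ∘ swapT j) = (fD (relayT j)).set v := by rw [set_fD_comp v _ h4, h1]
  have hstep : ∃ᶠ k in atTop, (prodBernoulli (mixW w k)).real (fX.set v) ≤
      (prodBernoulli (mixW w k)).real (fOA.set v) * (prodBernoulli (mixW w k)).real ((fD (relayT j)).set v) := by
    refine hj.mono fun k hk => ?_
    have h2 : (prodBernoulli (mixW w k)).real ((fD 2).set (v ∘ swapT j)) ≤ (prodBernoulli (mixW w k)).real ((fD 1).set (v ∘ swapT j)) := by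
      obtain ⟨i', hi'⟩ := hperm 1
      rw [hD1, show (fD 2 : Formula) = fD (relayT 1) from rfl, set_fD_comp v _ h4, hi']
      exact hk i'
    have h3 : (prodBernoulli (mixW w k)).real ((fD 3).set (v ∘ swapT j)) ≤ (prodBernoulli (mixW w k)).real ((fD 1).set (v ∘ swapT j)) := by
      obtain ⟨i', hi'⟩ := hperm 2
      rw [hD1, show (fD 3 : Formula) = fD (relayT 2) from rfl, set_fD_comp v _ h4, hi']
      exact hk i'
    have := cond_interior C hvalid hxs hnb hcheck hterm (mixW w k) (fun e _ => mixW_pos_lt_one w k e) hvj h2 h3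
    rwa [set_fX_swap, set_fOA_swap, hD1] at this
  -- pass to the limit
  have hlim := le_of_frequently_le
    (((stub_weightContinuity n (fX.set v)).tendsto w).comp (tendsto_mixW w))
    ((((stub_weightContinuity n (fOA.set v)).tendsto w).comp (tendsto_mixW w)).mul
      (((stub_weightContinuity n ((fD (relayT j)).set v)).tendsto w).comp (tendsto_mixW w))) hstep
  refine hlim.trans (mul_le_mul_of_nonneg_left ?_ measureReal_nonneg)
  fin_cases j
  · exact le_max_left _ _
  · exact (le_max_left _ _).trans (le_max_right _ _)
  · exact (le_max_right _ _).trans (le_max_right _ _)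

/-! ## The target in the route's vocabulary -/

/-- `X.set v = {v0 ↮ v4} ∩ ({v0 ↔ v1} ∪ {v0 ↔ v2} ∪ {v0 ↔ v3})`. [folklore] -/
theorem set_fX (v : Fin 5 → Fin n) : fX.set v = (openConn (v 0) (v 4) : Set (BondConfig (Fin n)))ᶜ ∩
    (openConn (v 0) (v 1) ∪ openConn (v 0) (v 2) ∪ openConn (v 0) (v 3)) := by
  ext ω
  simp only [fX, mem_set_cons, not_mem_set_nil, List.forall_mem_cons, forall_mem_nil_iff, holds_true, holds_false,
    and_true, or_false, mem_inter_iff, mem_union, mem_compl_iff]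
  tauto

/-- `oA.set v = {v0 ↔ v1} ∪ {v0 ↔ v2} ∪ {v0 ↔ v3}`. [folklore] -/
theorem set_fOA (v : Fin 5 → Fin n) : fOA.set v =
    (openConn (v 0) (v 1) ∪ openConn (v 0) (v 2) ∪ openConn (v 0) (v 3) : Set (BondConfig (Fin n))) := by
  ext ω
  simp only [fOA, mem_set_cons, not_mem_set_nil, List.forall_mem_cons, forall_mem_nil_iff, holds_true,
    and_true, or_false, mem_union]
  tauto

/-- `(D t).set v = {v t ↮ v 4}`. [folklore] -/
theorem set_fD (v : Fin 5 → Fin n) (t : Fin 5) : (fD t).set v = (openConn (v t) (v 4) : Set (BondConfig (Fin n)))ᶜ := by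
  ext ω
  simp only [fD, mem_set_cons, not_mem_set_nil, List.forall_mem_cons, forall_mem_nil_iff, holds_false, and_true,
    or_false, mem_compl_iff]

/-- **COND₃ from a certificate, connection-event form.**  For every weighted graph and injective placement `v`
(`v 0 = o`, `v 1,2,3` = relays, `v 4 = b`):
`μ({o ↮ b} ∩ ({o↔a₁} ∪ {o↔a₂} ∪ {o↔a₃})) ≤ μ({o↔a₁} ∪ {o↔a₂} ∪ {o↔a₃}) · max_j μ(a_j ↮ b)`. [folklore] -/
theorem cond_openConn_of_injective (C : CondCert) (hvalid : valid C = true) (hxs : C.ExtSound) {nb : ℕ} (hnb : 0 < nb)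
    (hcheck : ∀ b < nb, checkB C nb b = true) (hterm : posTerm C = true)
    (w : Sym2 (Fin n) → unitInterval) {v : Fin 5 → Fin n} (hv : Function.Injective v) :
    (prodBernoulli w).real ((openConn (v 0) (v 4) : Set (BondConfig (Fin n)))ᶜ ∩
        (openConn (v 0) (v 1) ∪ openConn (v 0) (v 2) ∪ openConn (v 0) (v 3))) ≤
      (prodBernoulli w).real (openConn (v 0) (v 1) ∪ openConn (v 0) (v 2) ∪ openConn (v 0) (v 3) : Set (BondConfig (Fin n))) *
        max ((prodBernoulli w).real (openConn (v 1) (v 4) : Set (BondConfig (Fin n)))ᶜ)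
          (max ((prodBernoulli w).real (openConn (v 2) (v 4) : Set (BondConfig (Fin n)))ᶜ)
            ((prodBernoulli w).real (openConn (v 3) (v 4) : Set (BondConfig (Fin n)))ᶜ)) := by
  have h := cond_max_of_injective C hvalid hxs hnb hcheck hterm w hv
  rwa [set_fX, set_fOA, set_fD, set_fD, set_fD] at h

/-- **COND₃ from a certificate, named vertices**: for pairwise distinct `o, a₁, a₂, a₃, b` with `a₁` a worst relay
(`μ(a_j ↮ b) ≤ μ(a₁ ↮ b)`), `μ({o ↮ b} ∩ ⋃ {o ↔ a_j}) ≤ μ(⋃ {o ↔ a_j}) · μ(a₁ ↮ b)`. [folklore] -/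
theorem condGluing_three_of_cert (C : CondCert) (hvalid : valid C = true) (hxs : C.ExtSound) {nb : ℕ} (hnb : 0 < nb)
    (hcheck : ∀ b < nb, checkB C nb b = true) (hterm : posTerm C = true)
    (w : Sym2 (Fin n) → unitInterval) (o a₁ a₂ a₃ b : Fin n)
    (h01 : o ≠ a₁) (h02 : o ≠ a₂) (h03 : o ≠ a₃) (h04 : o ≠ b) (h12 : a₁ ≠ a₂) (h13 : a₁ ≠ a₃) (h14 : a₁ ≠ b)
    (h23 : a₂ ≠ a₃) (h24 : a₂ ≠ b) (h34 : a₃ ≠ b)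
    (hw2 : (prodBernoulli w).real (openConn a₂ b : Set (BondConfig (Fin n)))ᶜ ≤ (prodBernoulli w).real (openConn a₁ b : Set (BondConfig (Fin n)))ᶜ)
    (hw3 : (prodBernoulli w).real (openConn a₃ b : Set (BondConfig (Fin n)))ᶜ ≤ (prodBernoulli w).real (openConn a₁ b : Set (BondConfig (Fin n)))ᶜ) :
    (prodBernoulli w).real ((openConn o b : Set (BondConfig (Fin n)))ᶜ ∩ (openConn o a₁ ∪ openConn o a₂ ∪ openConn o a₃)) ≤
      (prodBernoulli w).real (openConn o a₁ ∪ openConn o a₂ ∪ openConn o a₃ : Set (BondConfig (Fin n))) *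
        (prodBernoulli w).real (openConn a₁ b : Set (BondConfig (Fin n)))ᶜ := by
  have h := cond_openConn_of_injective C hvalid hxs hnb hcheck hterm w
    (CertEG3.injective_vec5 h01 h02 h03 h04 h12 h13 h14 h23 h24 h34)
  have hmax : max ((prodBernoulli w).real (openConn a₁ b : Set (BondConfig (Fin n)))ᶜ)
      (max ((prodBernoulli w).real (openConn a₂ b : Set (BondConfig (Fin n)))ᶜ)
        ((prodBernoulli w).real (openConn a₃ b : Set (BondConfig (Fin n)))ᶜ)) =
      (prodBernoulli w).real (openConn a₁ b : Set (BondConfig (Fin n)))ᶜ :=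
    max_eq_left (max_le hw2 hw3)
  simpa [hmax] using h


/-! ## All relay sets with at most three relays; Kozma–Nitzan's Conjecture 1 for `|A| ≤ 3` -/

/-- The union over a three-element Finset. [folklore] -/
theorem biUnion_three (o a₁ a₂ a₃ : Fin n) :
    (⋃ a ∈ ({a₁, a₂, a₃} : Finset (Fin n)), (openConn o a : Set (BondConfig (Fin n)))) =
      (openConn o a₁ ∪ openConn o a₂ ∪ openConn o a₃ : Set (BondConfig (Fin n))) := by
  ext ω
  simp only [Finset.mem_insert, Finset.mem_singleton, Set.mem_iUnion, Set.mem_union, exists_prop]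
  constructor
  · rintro ⟨a, (rfl | rfl | rfl), h⟩
    · exact Or.inl (Or.inl h)
    · exact Or.inl (Or.inr h)
    · exact Or.inr h
  · rintro ((h | h) | h)
    · exact ⟨a₁, Or.inl rfl, h⟩
    · exact ⟨a₂, Or.inr (Or.inl rfl), h⟩
    · exact ⟨a₃, Or.inr (Or.inr rfl), h⟩

/-- **COND for every relay set with at most three relays, from a certificate.**  For every finite weighted graph, observer `o`, sink
`b`, `A` with `A.card ≤ 3` and a worst relay `a₁ ∈ A`: `μ({o ↮ b} ∩ {o ↔ A}) ≤ μ(o ↔ A) · μ(a₁ ↮ b)`.  (`|A| ≤ 2` is the landed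
`CondGluing.condGluing_card_le_two`; coincidences `o = b`, `o ∈ A`, `b ∈ A` are elementary; five distinct vertices = the certificate.)
[folklore] -/
theorem condGluing_card_le_three_of_cert (C : CondCert) (hvalid : valid C = true) (hxs : C.ExtSound) {nb : ℕ} (hnb : 0 < nb)
    (hcheck : ∀ b < nb, checkB C nb b = true) (hterm : posTerm C = true)
    (w : Sym2 (Fin n) → unitInterval) (A : Finset (Fin n)) (o b a₁ : Fin n) (hA : A.card ≤ 3) (ha₁ : a₁ ∈ A)
    (hworst : ∀ a ∈ A, (prodBernoulli w).real (openConn a b : Set (BondConfig (Fin n)))ᶜ ≤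
      (prodBernoulli w).real (openConn a₁ b : Set (BondConfig (Fin n)))ᶜ) :
    (prodBernoulli w).real ((openConn o b : Set (BondConfig (Fin n)))ᶜ ∩ ⋃ a ∈ A, openConn o a) ≤
      (prodBernoulli w).real (⋃ a ∈ A, (openConn o a : Set (BondConfig (Fin n)))) *
        (prodBernoulli w).real (openConn a₁ b : Set (BondConfig (Fin n)))ᶜ := by
  haveI : IsProbabilityMeasure (prodBernoulli w) := inferInstance
  set μ := prodBernoulli w with hμ
  set d : Fin n → ℝ := fun x => μ.real (openConn x b : Set (BondConfig (Fin n)))ᶜ with hd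
  have hd0 : ∀ x, 0 ≤ d x := fun x => measureReal_nonneg
  by_cases hA2 : A.card ≤ 2
  · exact CondGluing.condGluing_card_le_two w A o b a₁ hA2 ha₁ hworst
  have hA3 : A.card = 3 := by omega
  -- degenerate observers / sinks
  by_cases hob : o = b
  · subst hob
    have h0 : ((openConn o o : Set (BondConfig (Fin n)))ᶜ ∩ ⋃ a ∈ A, openConn o a) = ∅ := by
      ext ω; simp [openConn]
    rw [h0, measureReal_empty]
    exact mul_nonneg measureReal_nonneg (hd0 _)
  by_cases hoA : o ∈ A
  · -- `{o ↔ A}` is sure, the left side is `μ(o ↮ b) = d o ≤ d a₁`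
    have hU : (⋃ a ∈ A, (openConn o a : Set (BondConfig (Fin n)))) = Set.univ := by
      refine Set.eq_univ_of_forall fun ω => Set.mem_iUnion₂.2 ⟨o, hoA, ?_⟩
      simp [openConn]
    rw [hU, Set.inter_univ, probReal_univ, one_mul]
    exact hworst o hoA
  by_cases hbA : b ∈ A
  · -- drop `b` from the relay set: the `a = b` piece is killed by `{o ↮ b}`
    have hU : ((openConn o b : Set (BondConfig (Fin n)))ᶜ ∩ ⋃ a ∈ A, openConn o a) =
        (openConn o b : Set (BondConfig (Fin n)))ᶜ ∩ ⋃ a ∈ A.erase b, openConn o a := by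
      ext ω
      simp only [Set.mem_inter_iff, Set.mem_compl_iff, Set.mem_iUnion, Finset.mem_erase, exists_prop]
      constructor
      · rintro ⟨hnb, a, ha, hω⟩
        refine ⟨hnb, a, ⟨?_, ha⟩, hω⟩
        rintro rfl; exact hnb hω
      · rintro ⟨hnb, a, ⟨_, ha⟩, hω⟩; exact ⟨hnb, a, ha, hω⟩
    have hne : (A.erase b).Nonempty := by
      rw [← Finset.card_pos, Finset.card_erase_of_mem hbA]; omega
    obtain ⟨a', ha', hmax⟩ := Finset.exists_max_image (A.erase b) d hne
    have hcard : (A.erase b).card ≤ 2 := by rw [Finset.card_erase_of_mem hbA]; omega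
    have h2 := CondGluing.condGluing_card_le_two w (A.erase b) o b a' hcard ha' hmax
    rw [hU]
    refine h2.trans (mul_le_mul ?_ (hworst a' (Finset.mem_of_mem_erase ha')) (hd0 _) measureReal_nonneg)
    exact measureReal_mono (Set.biUnion_subset_biUnion_left fun a ha => Finset.mem_of_mem_erase ha) (measure_ne_top _ _)
  -- general position: `A = {a₁, a₂, a₃}`, five distinct vertices
  obtain ⟨x, y, z, hxy, hxz, hyz, hAxyz⟩ := Finset.card_eq_three.1 hA3
  -- name the two relays other than `a₁`
  have key : ∀ a₂ a₃ : Fin n, a₁ ≠ a₂ → a₁ ≠ a₃ → a₂ ≠ a₃ → A = {a₁, a₂, a₃} →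
      μ.real ((openConn o b : Set (BondConfig (Fin n)))ᶜ ∩ ⋃ a ∈ A, openConn o a) ≤
        μ.real (⋃ a ∈ A, (openConn o a : Set (BondConfig (Fin n)))) * d a₁ := by
    intro a₂ a₃ h12 h13 h23 hA'
    have ha₂ : a₂ ∈ A := by rw [hA']; simp
    have ha₃ : a₃ ∈ A := by rw [hA']; simp
    have h01 : o ≠ a₁ := fun h => hoA (h ▸ ha₁)
    have h02 : o ≠ a₂ := fun h => hoA (h ▸ ha₂)
    have h03 : o ≠ a₃ := fun h => hoA (h ▸ ha₃)
    have h14 : a₁ ≠ b := fun h => hbA (h ▸ ha₁)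
    have h24 : a₂ ≠ b := fun h => hbA (h ▸ ha₂)
    have h34 : a₃ ≠ b := fun h => hbA (h ▸ ha₃)
    have hc := condGluing_three_of_cert C hvalid hxs hnb hcheck hterm w o a₁ a₂ a₃ b h01 h02 h03 hob h12 h13 h14 h23 h24 h34
      (hworst a₂ ha₂) (hworst a₃ ha₃)
    rw [hA', biUnion_three]
    exact hc
  rw [hAxyz] at ha₁
  simp only [Finset.mem_insert, Finset.mem_singleton] at ha₁
  rcases ha₁ with rfl | rfl | rfl
  · exact key y z hxy hxz hyz hAxyz
  · refine key x z (Ne.symm hxy) hyz hxz ?_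
    rw [hAxyz]; ext v; simp only [Finset.mem_insert, Finset.mem_singleton]; tauto
  · refine key x y (Ne.symm hxz) (Ne.symm hyz) hxy ?_
    rw [hAxyz]; ext v; simp only [Finset.mem_insert, Finset.mem_singleton]; tauto

/-- **Kozma–Nitzan's Conjecture 1 (post-FKG) for every `|A| ≤ 3`, from a certificate**: for every finite weighted graph, `A` with
`A.card ≤ 3`, observer `o`, target `b` and `t ≤ μ(a ↔ b)` on `A`:  `μ(o ↔ A) · t ≤ μ(o ↔ b)` — the signature of the registered
conjecture `KozmaNitzan2024_conjecture1` restricted to three relays. [cite: KozmaNitzan2024, Conjecture 1 (p. 3)] -/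
theorem kozmaNitzan_conjecture1_card_le_three_of_cert (C : CondCert) (hvalid : valid C = true) (hxs : C.ExtSound) {nb : ℕ} (hnb : 0 < nb)
    (hcheck : ∀ b < nb, checkB C nb b = true) (hterm : posTerm C = true)
    (w : Sym2 (Fin n) → unitInterval) (A : Finset (Fin n)) (o b : Fin n) (hA : A.card ≤ 3) (t : ℝ)
    (ht : ∀ a ∈ A, t ≤ (prodBernoulli w).real (openConn a b)) :
    (prodBernoulli w).real (⋃ a ∈ A, openConn o a) * t ≤ (prodBernoulli w).real (openConn o b) := by
  set μ := prodBernoulli w with hμ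
  set d : Fin n → ℝ := fun x => μ.real (openConn x b : Set (BondConfig (Fin n)))ᶜ with hd
  rcases A.eq_empty_or_nonempty with hAe | hAne
  · subst hAe
    simp only [Finset.notMem_empty, Set.iUnion_of_empty, Set.iUnion_empty, measureReal_empty, zero_mul]
    exact measureReal_nonneg
  obtain ⟨a₁, ha₁, hmax⟩ := Finset.exists_max_image A d hAne
  exact CondGluing.kozmaNitzan_conjecture1_of_condGluing_at w A o b a₁ ha₁
    (condGluing_card_le_three_of_cert C hvalid hxs hnb hcheck hterm w A o b a₁ hA ha₁ hmax) t ht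

end CondCert

end Summit.CriticalPhenomena.PercolationContinuityZ3.Theorems

end
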